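import Literature.MathematicalPhysics.QuantumFieldTheory.Balaban1983to89.Beta.OneLoop

/-!
# `BalabanUV.Beta.GAN24.ResolventFamilyJets` — binder row G-an2-4 ∕ (CONV-C), route R7 «TWO CURRENCIES», PART 164: THE MULTIVARIATE BACKGROUND JET — the second Fréchet derivative of the INVERSE
# along a `C²` matrix field; affine pencils `A(B) = D + Σ_i B_i•P_i`; the resolvent `R(B) = A(B)⁻¹` and the sandwich-inverse `Σ(B) = (Q·R(B)·Q′)⁻¹ + S₀`: `∂_uΣ = c⁻¹X_uc⁻¹`,
# `∂_u∂_vΣ = c⁻¹X_uc⁻¹X_vc⁻¹ + c⁻¹X_vc⁻¹X_uc⁻¹ − c⁻¹(X_{uv} + X_{vu})c⁻¹` (`c = Q·R₀·Q′`, `X_u = Q·R₀(Σ_i u_iP_i)R₀·Q′`, `X_{uv} = Q·R₀(Σ_i u_iP_i)R₀(Σ_i v_iP_i)R₀·Q′`), and the ENTRYWISE readings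
# at `B = 0` along the coordinate vectors — literally the inputs `hΔ`, `Family.dΔ`, `Family.d2Δ` of an2's `LogDetHessian.Family.polarization_master` (unit b2b-balaban-gan24-p3, gen 57; v1)

NOT IN PRINT; OUR PROOF ([folklore] finite-dimensional calculus over Mathlib BY NAME — `hasFDerivAt_ringInverse` ∕ `contDiffAt_ringInverse` on the complete normed algebra `Matrix p p ℝ`,
`HasFDerivAt.clm_apply ∕ clm_comp`, `contDiffAt_succ_iff_hasFDerivAt`, `Matrix.nonsing_inv_eq_ringInverse`, `LinearMap.toContinuousLinearMap` — in the scoped `ℓ²`-OPERATOR norm `Matrix.Norms.L2Operator`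
(PART 161's currency; its topology and uniformity are Mathlib's global ones on `Matrix` by construction, so NO instance attribute is removed); the pattern is an2 ∕ pv09's `Beta.LogDetHessian`
Part 1 (there in the `L^∞` norm with the global topology erased), re-derived in this currency.)  [Balaban1987RG1] (1.20) p. 264 LOCATES the shape («Π^{ab}_{j+1,μν}(g_j,x,x′) =
(δ²∕δB^a_μ(x)δB^b_ν(x′) E^{(j+1)})(g_j,0)» — a MIXED second partial in two background directions); nothing printed is a hypothesis.
HONEST FRAMING (cell contract, verbatim): «discharging `BetaPertH` makes Bałaban's UV stability UNCONDITIONAL — a real constructive-QFT result; it is NOT the continuum limit and NOT the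
Clay problem.»  HONEST DEPENDENCY (verbatim): «continuum YM on T⁴ ⇐ BetaPertH ∧ nine spine estimates (0/9 proved); BetaPertH ⇐ (D1) ∧ (D4) ∧ CAP+tail; G-an2-4 gates asym, D1 and NE2/3/4.»

WHY (gen 56's «WHAT IT DOES NOT DO», PART 161 docstring, verbatim: «several background directions at once (polarisation of §2 along `Σ_i s_iV_i`, or the word version of §2)»).  PART 161
(`BackgroundExpansionTaylor`) typed the ONE-PARAMETER jet `∂^N_u[(ΦR(u))⁻¹]` along a resolvent LINE; the β-cell's one-loop object (1.20) is a Hessian in TWO background directions, read by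
pv25's `OneLoop.polarization F i j = iteratedFDeriv ℝ 2 F.logZ 0 ![e_i, e_j]` and computed by an2's `LogDetHessian.Family.polarization_master` from the ENTRYWISE data `hΔ : ∀ a b, ContDiffAt ℝ 2
(fun B => (F B).Δ a b) 0`, `Family.dΔ F i = of (a b ↦ fderiv (B ↦ Δ(B) a b) 0 e_i)`, `Family.d2Δ F i j = of (a b ↦ hessianAt (B ↦ Δ(B) a b) i j)`.  This file supplies exactly these data for
every family in RESOLVENT FORM `Δ(B) = (Q·(D + Σ_i B_i•P_i)⁻¹·Q′)⁻¹ + S₀` — the shape of the lineage's effective form with background `Σ_k(B) = (L^{dk}Q_k(Δ_a^{(k)} + Σ_i B_iP(V_i)^{(k)})⁻¹Q_kᴴ)⁻¹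
− a″1` (PARTs 118 ∕ 152 ∕ 161; `P(V)` linear in the background, NE2's `FirstOrderBackgroundModel.Pmodel`) — as INSERTION WORDS (PARTs 156 ∕ 159): first jet `c⁻¹X_ic⁻¹` (PART 147's `Σ̇`),
mixed second jet `c⁻¹X_ic⁻¹X_jc⁻¹ + c⁻¹X_jc⁻¹X_ic⁻¹ − c⁻¹(X_{ij} + X_{ji})c⁻¹` (PART 157's `Σ̈ = 2(c⁻¹X¹c⁻¹X¹c⁻¹ − c⁻¹X²c⁻¹)` is its diagonal `i = j`).  PART 165 feeds them to `polarization_master`.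

WHAT THIS FILE PROVES (0 sorry, 0 `def`; real matrices, `E` any real normed space, `p`, `q`, `ι` finite index types):
* §1 (GENERIC, `K : E → Matrix p p ℝ`) `eventually_isUnit_det`, `local_fderiv_data`, `fderiv_clm_apply`, `of_fderiv_entry`, `hasFDerivAt_nonsing_inv`
  (`D(K⁻¹)(x) = −K⁻¹·DK(x)·K⁻¹` as ONE continuous linear map), `fderiv_nonsing_inv_apply`, `differentiableAt_nonsing_inv`, `contDiffAt_nonsing_inv` (`C^k` field, nonsingular point ⟹
  `K⁻¹` is `C^k` there), `fderiv_fderiv_clm_apply` ∕ `of_fderiv_fderiv_entry` (continuous linear maps ∕ entries commute with `D²`), **`fderiv_fderiv_nonsing_inv`**: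
  `D²(K⁻¹)(x₀)[u,v] = K₀⁻¹K_uK₀⁻¹K_vK₀⁻¹ + K₀⁻¹K_vK₀⁻¹K_uK₀⁻¹ − K₀⁻¹K_{uv}K₀⁻¹` (`K_u = DK(x₀)u`, `K_{uv} = D²K(x₀)[u,v]`).
* §2 (AFFINE PENCILS `B ↦ D + Σ_i B_i•P_i` on `ι → ℝ`) `hasFDerivAt_pencil`, `fderiv_pencil_apply` (`= Σ_i u_i•P_i`), `contDiff_pencil`, `fderiv_fderiv_pencil` (`= 0`); the RESOLVENT at a
  point `B₀` with `A(B₀)` nonsingular: `contDiffAt_resolvent`, **`fderiv_resolvent_apply`** (`= −R₀(Σu_iP_i)R₀`), **`fderiv_fderiv_resolvent_apply`** (`= R₀(Σu_iP_i)R₀(Σv_iP_i)R₀ + (u ↔ v)`).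
* §3 (THE SANDWICH-INVERSE, `Q : q × p`, `Q′ : p × q`, `S₀ : q × q`, at `B₀` with `A(B₀)` and `c₀ = Q·R₀·Q′` nonsingular) `exists_clm_sandwich`, `contDiffAt_sandwich`, `fderiv_sandwich_apply`,
  `fderiv_fderiv_sandwich_apply`, `contDiffAt_effFormPencil`, **`fderiv_effFormPencil_apply`** (`= c₀⁻¹X_uc₀⁻¹`), **`fderiv_fderiv_effFormPencil_apply`** (the displayed mixed second jet).
* §4 (ENTRYWISE READINGS AT `B = 0` — norm-free statements, the `Family` currency) `sum_smul_single`, `pencil_zero`, **`contDiffAt_effFormPencil_entry`** (`∀ a b, ContDiffAt ℝ k (B ↦ Σ(B) a b) 0`),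
  **`of_fderiv_effFormPencil_entry_single`** (`of (a b ↦ fderiv (B ↦ Σ(B) a b) 0 e_i) = c⁻¹X_ic⁻¹`, `c = Q·D⁻¹·Q′`, `X_i = Q·D⁻¹P_iD⁻¹·Q′`), **`of_hessianAt_effFormPencil_entry`**
  (`of (a b ↦ hessianAt (B ↦ Σ(B) a b) i j) = c⁻¹X_ic⁻¹X_jc⁻¹ + c⁻¹X_jc⁻¹X_ic⁻¹ − c⁻¹(X_{ij} + X_{ji})c⁻¹`, `X_{ij} = Q·D⁻¹P_iD⁻¹P_jD⁻¹·Q′`).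
TECHNICAL NOTE: §1–§3 statements mention `Matrix _ _ ℝ` as a normed space and elaborate against the scoped `Matrix.Norms.L2Operator` instances (an importer opens the same scope to use them);
§4 is norm-free.  WHAT IT IS NOT: no trace ∕ `log det` here (PART 165); nothing about the lineage's `ℂ`-valued towers is instantiated (their real structure is a separate dictionary); NOT
Bałaban's `Δ^{(k)}(U_{k+1}(exp iB))` ∕ `U_k` ∕ shaped `P_B` (row an1's dictionary).  SUPPLIER work; NEVER «G-an2-4 closed»; NOT (CONV-C), NOT D1, NOT `BetaPertH`, NOT continuum, NOT Clay.
Records: `HOME/b2b-balaban-gan24-p3/gen57/README.md`.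
-/

noncomputable section

open Matrix Topology Filter
open scoped Matrix.Norms.L2Operator BigOperators

namespace Summit.QuantumFields.BalabanUV.Beta.GAN24.ResolventFamilyJets

open Literature.MathematicalPhysics.QuantumFieldTheory.Balaban1983to89.Beta (hessianAt)

/-! ## §1 Generic: the inverse along a `C²` matrix field — first and second Fréchet derivatives -/

section Inverse

variable {E : Type*} [NormedAddCommGroup E] [NormedSpace ℝ E] {p : Type*} [Fintype p] [DecidableEq p]

omit [NormedSpace ℝ E] in
/-- Nonsingularity is open along a continuous matrix field. [folklore] -/
theorem eventually_isUnit_det {K : E → Matrix p p ℝ} {x₀ : E} (hK : ContinuousAt K x₀) (h0 : IsUnit (K x₀).det) :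
    ∀ᶠ x in 𝓝 x₀, IsUnit (K x).det := by
  have hc : ContinuousAt (fun x => (K x).det) x₀ :=
    ((continuous_id (X := Matrix p p ℝ)).matrix_det.continuousAt).comp hK
  exact (hc.eventually_ne h0.ne_zero).mono fun x hx => isUnit_iff_ne_zero.2 hx

/-- Local first-derivative data of a map `C²` at `x₀`: a derivative field `K'` valid near `x₀`, agreeing with `fderiv` near `x₀`, and differentiable at `x₀`
(Mathlib's `contDiffAt_succ_iff_hasFDerivAt`; cf. an2's `LogDetHessian.exists_local_fderiv`, whose `L^∞`-currency statement is not importable here). [folklore] -/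
theorem local_fderiv_data {F : Type*} [NormedAddCommGroup F] [NormedSpace ℝ F] {K : E → F} {x₀ : E} (hK : ContDiffAt ℝ 2 K x₀) :
    ∃ K' : E → E →L[ℝ] F, (∀ᶠ x in 𝓝 x₀, HasFDerivAt K (K' x) x) ∧ fderiv ℝ K =ᶠ[𝓝 x₀] K' ∧ HasFDerivAt K' (fderiv ℝ K' x₀) x₀ := by
  have hK1 : ContDiffAt ℝ ((1 : ℕ) + 1) K x₀ := by
    have h2 : ((1 : ℕ) : WithTop ℕ∞) + 1 = 2 := by norm_num
    rw [h2]; exact hK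
  obtain ⟨K', ⟨U, hU, hK'⟩, hK'1⟩ := contDiffAt_succ_iff_hasFDerivAt.1 hK1
  have hev : ∀ᶠ x in 𝓝 x₀, HasFDerivAt K (K' x) x := Filter.eventually_of_mem hU hK'
  have h1 : ContDiffAt ℝ 1 K' x₀ := by simpa using hK'1
  exact ⟨K', hev, hev.mono fun x hx => hx.fderiv, (h1.differentiableAt one_ne_zero).hasFDerivAt⟩

/-- A continuous linear map commutes with the first derivative: `D(Φ ∘ K)(x₀)u = Φ(DK(x₀)u)`. [folklore] -/
theorem fderiv_clm_apply {F G : Type*} [NormedAddCommGroup F] [NormedSpace ℝ F] [NormedAddCommGroup G] [NormedSpace ℝ G]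
    (Φ : F →L[ℝ] G) {K : E → F} {x₀ : E} (hK : DifferentiableAt ℝ K x₀) (u : E) :
    fderiv ℝ (fun y => Φ (K y)) x₀ u = Φ (fderiv ℝ K x₀ u) := by
  have h : HasFDerivAt (fun y => Φ (K y)) (Φ.comp (fderiv ℝ K x₀)) x₀ := Φ.hasFDerivAt.comp x₀ hK.hasFDerivAt
  rw [h.fderiv]
  rfl

/-- The matrix of the derivatives of the entries is the derivative: `of (a b ↦ D(K_{ab})(x₀)u) = DK(x₀)u` (entrywise, an2's `LogDetHessian.fderiv_apply_entry` in the `L^∞` currency). [folklore] -/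
theorem of_fderiv_entry {K : E → Matrix p p ℝ} {x₀ : E} (hK : DifferentiableAt ℝ K x₀) (u : E) :
    Matrix.of (fun a b => fderiv ℝ (fun y => K y a b) x₀ u) = fderiv ℝ K x₀ u := by
  ext a b
  exact fderiv_clm_apply (LinearMap.toContinuousLinearMap (Matrix.entryLinearMap ℝ ℝ a b)) hK u

/-- **`D(K⁻¹)(x) = −K(x)⁻¹·DK(x)·K(x)⁻¹`** as ONE continuous linear map (Mathlib's `hasFDerivAt_ringInverse` + chain rule; an2's `LogDetHessian.hasFDerivAt_inv` is the `L^∞` twin). [folklore] -/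
theorem hasFDerivAt_nonsing_inv {K : E → Matrix p p ℝ} {K' : E →L[ℝ] Matrix p p ℝ} {x : E}
    (hK : HasFDerivAt K K' x) (h0 : IsUnit (K x).det) :
    HasFDerivAt (fun y => (K y)⁻¹) ((-ContinuousLinearMap.mulLeftRight ℝ (Matrix p p ℝ) (K x)⁻¹ (K x)⁻¹).comp K') x := by
  haveI : CompleteSpace (Matrix p p ℝ) := FiniteDimensional.complete ℝ (Matrix p p ℝ)
  obtain ⟨w, hw⟩ := (Matrix.isUnit_iff_isUnit_det (K x)).2 h0
  -- `D(A ↦ A⁻¹)(A) = −A⁻¹·A⁻¹` on the normed algebra (Mathlib's `hasFDerivAt_ringInverse`, `Matrix.nonsing_inv_eq_ringInverse`), then the chain rule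
  have hinv : HasFDerivAt (fun M : Matrix p p ℝ => M⁻¹) (-ContinuousLinearMap.mulLeftRight ℝ (Matrix p p ℝ) (K x)⁻¹ (K x)⁻¹) (K x) := by
    have h := hasFDerivAt_ringInverse (𝕜 := ℝ) w
    have hf : (fun M : Matrix p p ℝ => M⁻¹) = Ring.inverse := funext fun M => Matrix.nonsing_inv_eq_ringInverse M
    have hwi : ((w⁻¹ : (Matrix p p ℝ)ˣ) : Matrix p p ℝ) = (K x)⁻¹ := by rw [Matrix.coe_units_inv, hw]
    rw [hf, ← hwi, ← hw]
    exact h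
  exact hinv.comp x hK

/-- `D(K⁻¹)(x₀)u = −K₀⁻¹·(DK(x₀)u)·K₀⁻¹`. [folklore] -/
theorem fderiv_nonsing_inv_apply {K : E → Matrix p p ℝ} {x₀ : E} (hK : DifferentiableAt ℝ K x₀) (h0 : IsUnit (K x₀).det) (u : E) :
    fderiv ℝ (fun y => (K y)⁻¹) x₀ u = -((K x₀)⁻¹ * fderiv ℝ K x₀ u * (K x₀)⁻¹) := by
  rw [(hasFDerivAt_nonsing_inv hK.hasFDerivAt h0).fderiv]
  simp only [ContinuousLinearMap.comp_apply, _root_.neg_apply, ContinuousLinearMap.mulLeftRight_apply]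

/-- `K⁻¹` is differentiable at a nonsingular point of a differentiable field. [folklore] -/
theorem differentiableAt_nonsing_inv {K : E → Matrix p p ℝ} {x₀ : E} (hK : DifferentiableAt ℝ K x₀) (h0 : IsUnit (K x₀).det) :
    DifferentiableAt ℝ (fun y => (K y)⁻¹) x₀ :=
  (hasFDerivAt_nonsing_inv hK.hasFDerivAt h0).differentiableAt

/-- **`C^k` field, nonsingular point ⟹ `K⁻¹` is `C^k` there** (Mathlib's `contDiffAt_ringInverse` on the complete normed algebra `Matrix p p ℝ`;
`Matrix.nonsing_inv_eq_ringInverse`). [folklore] -/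
theorem contDiffAt_nonsing_inv {k : WithTop ℕ∞} {K : E → Matrix p p ℝ} {x₀ : E} (hK : ContDiffAt ℝ k K x₀) (h0 : IsUnit (K x₀).det) :
    ContDiffAt ℝ k (fun y => (K y)⁻¹) x₀ := by
  haveI : CompleteSpace (Matrix p p ℝ) := FiniteDimensional.complete ℝ (Matrix p p ℝ)
  have hf : (fun y => (K y)⁻¹) = fun y => Ring.inverse (K y) := funext fun y => Matrix.nonsing_inv_eq_ringInverse (K y)
  obtain ⟨w, hw⟩ := (Matrix.isUnit_iff_isUnit_det (K x₀)).2 h0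
  have h1 : ContDiffAt ℝ k Ring.inverse (K x₀) := by rw [← hw]; exact contDiffAt_ringInverse ℝ w
  rw [hf]
  exact h1.comp x₀ hK

/-- A continuous linear map commutes with the second Fréchet derivative of a `C²` map: `D²(Φ ∘ K)(x₀)[u,v] = Φ(D²K(x₀)[u,v])`
(an2's `LogDetHessian.fderiv_fderiv_apply_entry` is the case of an entry functional). [folklore] -/
theorem fderiv_fderiv_clm_apply {F G : Type*} [NormedAddCommGroup F] [NormedSpace ℝ F] [NormedAddCommGroup G] [NormedSpace ℝ G]
    (Φ : F →L[ℝ] G) {K : E → F} {x₀ : E} (hK : ContDiffAt ℝ 2 K x₀) (u v : E) :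
    fderiv ℝ (fderiv ℝ (fun y => Φ (K y))) x₀ u v = Φ (fderiv ℝ (fderiv ℝ K) x₀ u v) := by
  obtain ⟨K', hK', hfK, hd⟩ := local_fderiv_data hK
  have h1 : fderiv ℝ (fun y => Φ (K y)) =ᶠ[𝓝 x₀] fun x => Φ.comp (K' x) :=
    hK'.mono fun x hx => (Φ.hasFDerivAt.comp x hx).fderiv
  have h2 : HasFDerivAt (fun x => Φ.comp (K' x))
      ((ContinuousLinearMap.compL ℝ E F G Φ).comp (fderiv ℝ K' x₀)) x₀ := by
    have h := (hasFDerivAt_const Φ x₀).clm_comp hd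
    simpa using h
  rw [(h2.congr_of_eventuallyEq h1).fderiv, hfK.fderiv_eq]
  rfl

/-- The matrix of the second derivatives of the entries is the second derivative: `of (a b ↦ D²(K_{ab})(x₀)[u,v]) = D²K(x₀)[u,v]` for `K` of class `C²` at `x₀`
(entrywise, an2's `LogDetHessian.fderiv_fderiv_apply_entry` in the `L^∞` currency). [folklore] -/
theorem of_fderiv_fderiv_entry {K : E → Matrix p p ℝ} {x₀ : E} (hK : ContDiffAt ℝ 2 K x₀) (u v : E) :
    Matrix.of (fun a b => fderiv ℝ (fderiv ℝ (fun y => K y a b)) x₀ u v) = fderiv ℝ (fderiv ℝ K) x₀ u v := by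
  ext a b
  exact fderiv_fderiv_clm_apply (LinearMap.toContinuousLinearMap (Matrix.entryLinearMap ℝ ℝ a b)) hK u v

/-- **THE SECOND FRÉCHET DERIVATIVE OF THE INVERSE ALONG A `C²` MATRIX FIELD** at a nonsingular point:
`D²(K⁻¹)(x₀)[u,v] = K₀⁻¹K_uK₀⁻¹K_vK₀⁻¹ + K₀⁻¹K_vK₀⁻¹K_uK₀⁻¹ − K₀⁻¹K_{uv}K₀⁻¹`, `K_u = DK(x₀)u`, `K_{uv} = D²K(x₀)[u,v]` (the first-derivative field
`x ↦ −K(x)⁻¹·DK(x)·K(x)⁻¹` differentiated once more: `HasFDerivAt.clm_apply ∕ clm_comp` on `mulLeftRight`). [folklore] -/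
theorem fderiv_fderiv_nonsing_inv {K : E → Matrix p p ℝ} {x₀ : E} (hK : ContDiffAt ℝ 2 K x₀) (h0 : IsUnit (K x₀).det) (u v : E) :
    fderiv ℝ (fderiv ℝ (fun y => (K y)⁻¹)) x₀ u v =
      (K x₀)⁻¹ * fderiv ℝ K x₀ u * (K x₀)⁻¹ * fderiv ℝ K x₀ v * (K x₀)⁻¹
        + (K x₀)⁻¹ * fderiv ℝ K x₀ v * (K x₀)⁻¹ * fderiv ℝ K x₀ u * (K x₀)⁻¹
        - (K x₀)⁻¹ * fderiv ℝ (fderiv ℝ K) x₀ u v * (K x₀)⁻¹ := by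
  obtain ⟨K', hK', hfK, hd⟩ := local_fderiv_data hK
  have hK0 : HasFDerivAt K (K' x₀) x₀ := hK'.self_of_nhds
  have hfK0 : fderiv ℝ K x₀ = K' x₀ := hK0.fderiv
  have hunit : ∀ᶠ x in 𝓝 x₀, IsUnit (K x).det := eventually_isUnit_det hK.continuousAt h0
  -- the first-derivative field near `x₀`, as a field of continuous linear maps (`H ↦ −K⁻¹HK⁻¹ = −((mul.flip K⁻¹) ∘ (mul K⁻¹)) H`)
  have hff : fderiv ℝ (fun y => (K y)⁻¹) =ᶠ[𝓝 x₀]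
      fun x => -((((ContinuousLinearMap.mul ℝ (Matrix p p ℝ)).flip (K x)⁻¹).comp
        ((ContinuousLinearMap.mul ℝ (Matrix p p ℝ)) (K x)⁻¹)).comp (K' x)) :=
    (hunit.and hK').mono fun x hx => by
      rw [(hasFDerivAt_nonsing_inv hx.2 hx.1).fderiv, ContinuousLinearMap.neg_comp]
      rfl
  -- derivative at `x₀` of `x ↦ K(x)⁻¹`, and of the two factors `x ↦ mul.flip K(x)⁻¹`, `x ↦ mul K(x)⁻¹`
  have hJ0 := hasFDerivAt_nonsing_inv hK0 h0
  have hc := ((ContinuousLinearMap.mul ℝ (Matrix p p ℝ)).flip).hasFDerivAt.comp x₀ hJ0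
  have hd' := (ContinuousLinearMap.mul ℝ (Matrix p p ℝ)).hasFDerivAt.comp x₀ hJ0
  have hC := ((hc.clm_comp hd').clm_comp hd).neg
  have h2 := hC.congr_of_eventuallyEq hff
  rw [h2.fderiv, hfK.fderiv_eq, hfK0]
  simp only [_root_.neg_apply, _root_.add_apply, ContinuousLinearMap.comp_apply, ContinuousLinearMap.compL_apply,
    ContinuousLinearMap.flip_apply, ContinuousLinearMap.mul_apply', ContinuousLinearMap.mulLeftRight_apply, Function.comp_apply]
  simp only [Matrix.mul_neg, Matrix.neg_mul, neg_neg, neg_add]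
  noncomm_ring

end Inverse

/-! ## §2 Affine pencils `B ↦ D + Σ_i B_i•P_i` and their resolvents -/

section Pencil

variable {ι : Type*} [Fintype ι] {p : Type*} [Fintype p] [DecidableEq p]

/-- The pencil is differentiable with derivative `u ↦ Σ_i u_i•P_i`. [folklore] -/
theorem hasFDerivAt_pencil (D : Matrix p p ℝ) (P : ι → Matrix p p ℝ) (B₀ : ι → ℝ) :
    HasFDerivAt (fun B : ι → ℝ => D + ∑ i, B i • P i)
      (∑ i, (ContinuousLinearMap.proj i : (ι → ℝ) →L[ℝ] ℝ).smulRight (P i)) B₀ := by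
  have h : ∀ i ∈ (Finset.univ : Finset ι), HasFDerivAt (fun B : ι → ℝ => B i • P i)
      ((ContinuousLinearMap.proj i : (ι → ℝ) →L[ℝ] ℝ).smulRight (P i)) B₀ := fun i _ =>
    ((ContinuousLinearMap.proj i : (ι → ℝ) →L[ℝ] ℝ).hasFDerivAt).smul_const (P i)
  exact (HasFDerivAt.fun_sum h).const_add D

/-- `D(B ↦ D + Σ_i B_i•P_i)(B₀)u = Σ_i u_i•P_i`. [folklore] -/
theorem fderiv_pencil_apply (D : Matrix p p ℝ) (P : ι → Matrix p p ℝ) (B₀ u : ι → ℝ) :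
    fderiv ℝ (fun B : ι → ℝ => D + ∑ i, B i • P i) B₀ u = ∑ i, u i • P i := by
  rw [(hasFDerivAt_pencil D P B₀).fderiv]
  simp [ContinuousLinearMap.smulRight_apply]

/-- The pencil is `C^∞`. [folklore] -/
theorem contDiff_pencil {k : WithTop ℕ∞} (D : Matrix p p ℝ) (P : ι → Matrix p p ℝ) :
    ContDiff ℝ k (fun B : ι → ℝ => D + ∑ i, B i • P i) :=
  contDiff_const.add (ContDiff.sum fun i _ => (contDiff_apply ℝ ℝ i).smul contDiff_const)

/-- The second derivative of the pencil vanishes. [folklore] -/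
theorem fderiv_fderiv_pencil (D : Matrix p p ℝ) (P : ι → Matrix p p ℝ) (B₀ u v : ι → ℝ) :
    fderiv ℝ (fderiv ℝ (fun B : ι → ℝ => D + ∑ i, B i • P i)) B₀ u v = 0 := by
  have h : fderiv ℝ (fun B : ι → ℝ => D + ∑ i, B i • P i) =
      fun _ => ∑ i, (ContinuousLinearMap.proj i : (ι → ℝ) →L[ℝ] ℝ).smulRight (P i) :=
    funext fun B => (hasFDerivAt_pencil D P B).fderiv
  rw [h, fderiv_fun_const]
  rfl

/-- The resolvent `R(B) = (D + Σ_i B_i•P_i)⁻¹` is `C^k` at every `B₀` with `D + Σ_i B₀_i•P_i` nonsingular. [folklore] -/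
theorem contDiffAt_resolvent {k : WithTop ℕ∞} (D : Matrix p p ℝ) (P : ι → Matrix p p ℝ) {B₀ : ι → ℝ} (hA : IsUnit (D + ∑ i, B₀ i • P i).det) :
    ContDiffAt ℝ k (fun B : ι → ℝ => (D + ∑ i, B i • P i)⁻¹) B₀ :=
  contDiffAt_nonsing_inv (K := fun B : ι → ℝ => D + ∑ i, B i • P i) (contDiff_pencil D P).contDiffAt hA

/-- **`D R(B₀) u = −R₀·(Σ_i u_i•P_i)·R₀`**, `R₀ = (D + Σ_i B₀_i•P_i)⁻¹`. [folklore] -/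
theorem fderiv_resolvent_apply (D : Matrix p p ℝ) (P : ι → Matrix p p ℝ) {B₀ : ι → ℝ} (hA : IsUnit (D + ∑ i, B₀ i • P i).det) (u : ι → ℝ) :
    fderiv ℝ (fun B : ι → ℝ => (D + ∑ i, B i • P i)⁻¹) B₀ u =
      -((D + ∑ i, B₀ i • P i)⁻¹ * (∑ i, u i • P i) * (D + ∑ i, B₀ i • P i)⁻¹) := by
  rw [fderiv_nonsing_inv_apply (K := fun B : ι → ℝ => D + ∑ i, B i • P i) (hasFDerivAt_pencil D P B₀).differentiableAt hA, fderiv_pencil_apply]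

/-- **`D²R(B₀)[u,v] = R₀(Σu_iP_i)R₀(Σv_iP_i)R₀ + R₀(Σv_iP_i)R₀(Σu_iP_i)R₀`** (the pencil has no second derivative). [folklore] -/
theorem fderiv_fderiv_resolvent_apply (D : Matrix p p ℝ) (P : ι → Matrix p p ℝ) {B₀ : ι → ℝ} (hA : IsUnit (D + ∑ i, B₀ i • P i).det) (u v : ι → ℝ) :
    fderiv ℝ (fderiv ℝ (fun B : ι → ℝ => (D + ∑ i, B i • P i)⁻¹)) B₀ u v =
      (D + ∑ i, B₀ i • P i)⁻¹ * (∑ i, u i • P i) * (D + ∑ i, B₀ i • P i)⁻¹ * (∑ i, v i • P i) * (D + ∑ i, B₀ i • P i)⁻¹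
        + (D + ∑ i, B₀ i • P i)⁻¹ * (∑ i, v i • P i) * (D + ∑ i, B₀ i • P i)⁻¹ * (∑ i, u i • P i) * (D + ∑ i, B₀ i • P i)⁻¹ := by
  rw [fderiv_fderiv_nonsing_inv (K := fun B : ι → ℝ => D + ∑ i, B i • P i) (contDiff_pencil D P).contDiffAt hA,
    fderiv_pencil_apply, fderiv_pencil_apply, fderiv_fderiv_pencil]
  simp

end Pencil

/-! ## §3 The sandwich-inverse `Σ(B) = (Q·R(B)·Q′)⁻¹ + S₀` -/

section Sandwich

variable {ι : Type*} [Fintype ι] {p q : Type*} [Fintype p] [DecidableEq p] [Fintype q] [DecidableEq q]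

omit [DecidableEq p] [Fintype q] [DecidableEq q] in
/-- `R ↦ Q·R·Q′` is a continuous linear map `Matrix p p ℝ →L Matrix q q ℝ` (finite dimension). [folklore] -/
theorem exists_clm_sandwich (Q : Matrix q p ℝ) (Q' : Matrix p q ℝ) :
    ∃ Φ : Matrix p p ℝ →L[ℝ] Matrix q q ℝ, ∀ R, Φ R = Q * R * Q' := by
  refine ⟨LinearMap.toContinuousLinearMap
    { toFun := fun R => Q * R * Q'
      map_add' := fun R S => by rw [Matrix.mul_add, Matrix.add_mul]
      map_smul' := fun c R => by rw [Matrix.mul_smul, Matrix.smul_mul, RingHom.id_apply] }, fun R => rfl⟩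

/-- The sandwich `B ↦ Q·R(B)·Q′` is `C^k` at `B₀`. [folklore] -/
theorem contDiffAt_sandwich {k : WithTop ℕ∞} (D : Matrix p p ℝ) (P : ι → Matrix p p ℝ) (Q : Matrix q p ℝ) (Q' : Matrix p q ℝ) {B₀ : ι → ℝ}
    (hA : IsUnit (D + ∑ i, B₀ i • P i).det) : ContDiffAt ℝ k (fun B : ι → ℝ => Q * (D + ∑ i, B i • P i)⁻¹ * Q') B₀ := by
  obtain ⟨Φ, hΦ⟩ := exists_clm_sandwich Q Q'
  have h : (fun B : ι → ℝ => Q * (D + ∑ i, B i • P i)⁻¹ * Q') = fun B => Φ ((D + ∑ i, B i • P i)⁻¹) := funext fun B => (hΦ _).symm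
  rw [h]
  exact Φ.contDiff.contDiffAt.comp B₀ (contDiffAt_resolvent D P hA)

/-- `D(Q·R·Q′)(B₀)u = −Q·R₀(Σu_iP_i)R₀·Q′`. [folklore] -/
theorem fderiv_sandwich_apply (D : Matrix p p ℝ) (P : ι → Matrix p p ℝ) (Q : Matrix q p ℝ) (Q' : Matrix p q ℝ) {B₀ : ι → ℝ}
    (hA : IsUnit (D + ∑ i, B₀ i • P i).det) (u : ι → ℝ) :
    fderiv ℝ (fun B : ι → ℝ => Q * (D + ∑ i, B i • P i)⁻¹ * Q') B₀ u =
      -(Q * ((D + ∑ i, B₀ i • P i)⁻¹ * (∑ i, u i • P i) * (D + ∑ i, B₀ i • P i)⁻¹) * Q') := by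
  obtain ⟨Φ, hΦ⟩ := exists_clm_sandwich Q Q'
  have h : (fun B : ι → ℝ => Q * (D + ∑ i, B i • P i)⁻¹ * Q') = fun B => Φ ((D + ∑ i, B i • P i)⁻¹) := funext fun B => (hΦ _).symm
  have hR : DifferentiableAt ℝ (fun B : ι → ℝ => (D + ∑ i, B i • P i)⁻¹) B₀ := (contDiffAt_resolvent (k := 1) D P hA).differentiableAt one_ne_zero
  have hcomp : HasFDerivAt (fun B : ι → ℝ => Φ ((D + ∑ i, B i • P i)⁻¹))
      (Φ.comp (fderiv ℝ (fun B : ι → ℝ => (D + ∑ i, B i • P i)⁻¹) B₀)) B₀ := Φ.hasFDerivAt.comp B₀ hR.hasFDerivAt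
  rw [h, hcomp.fderiv, ContinuousLinearMap.comp_apply, fderiv_resolvent_apply D P hA, map_neg, hΦ]

/-- `D²(Q·R·Q′)(B₀)[u,v] = Q·(R₀(Σu_iP_i)R₀(Σv_iP_i)R₀ + R₀(Σv_iP_i)R₀(Σu_iP_i)R₀)·Q′`. [folklore] -/
theorem fderiv_fderiv_sandwich_apply (D : Matrix p p ℝ) (P : ι → Matrix p p ℝ) (Q : Matrix q p ℝ) (Q' : Matrix p q ℝ) {B₀ : ι → ℝ}
    (hA : IsUnit (D + ∑ i, B₀ i • P i).det) (u v : ι → ℝ) :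
    fderiv ℝ (fderiv ℝ (fun B : ι → ℝ => Q * (D + ∑ i, B i • P i)⁻¹ * Q')) B₀ u v =
      Q * ((D + ∑ i, B₀ i • P i)⁻¹ * (∑ i, u i • P i) * (D + ∑ i, B₀ i • P i)⁻¹ * (∑ i, v i • P i) * (D + ∑ i, B₀ i • P i)⁻¹
        + (D + ∑ i, B₀ i • P i)⁻¹ * (∑ i, v i • P i) * (D + ∑ i, B₀ i • P i)⁻¹ * (∑ i, u i • P i) * (D + ∑ i, B₀ i • P i)⁻¹) * Q' := by
  obtain ⟨Φ, hΦ⟩ := exists_clm_sandwich Q Q'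
  have h : (fun B : ι → ℝ => Q * (D + ∑ i, B i • P i)⁻¹ * Q') = fun B => Φ ((D + ∑ i, B i • P i)⁻¹) := funext fun B => (hΦ _).symm
  rw [h, fderiv_fderiv_clm_apply Φ (contDiffAt_resolvent D P hA), fderiv_fderiv_resolvent_apply D P hA, hΦ]

/-- The sandwich-inverse `Σ(B) = (Q·R(B)·Q′)⁻¹ + S₀` is `C^k` at `B₀` when `A(B₀)` and `c₀ = Q·R₀·Q′` are nonsingular. [folklore] -/
theorem contDiffAt_effFormPencil {k : WithTop ℕ∞} (D : Matrix p p ℝ) (P : ι → Matrix p p ℝ) (Q : Matrix q p ℝ) (Q' : Matrix p q ℝ) (S₀ : Matrix q q ℝ)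
    {B₀ : ι → ℝ} (hA : IsUnit (D + ∑ i, B₀ i • P i).det) (hc : IsUnit (Q * (D + ∑ i, B₀ i • P i)⁻¹ * Q').det) :
    ContDiffAt ℝ k (fun B : ι → ℝ => (Q * (D + ∑ i, B i • P i)⁻¹ * Q')⁻¹ + S₀) B₀ :=
  (contDiffAt_nonsing_inv (K := fun B : ι → ℝ => Q * (D + ∑ i, B i • P i)⁻¹ * Q') (contDiffAt_sandwich D P Q Q' hA) hc).add contDiffAt_const

/-- **THE FIRST JET: `DΣ(B₀)u = c₀⁻¹·X_u·c₀⁻¹`**, `c₀ = Q·R₀·Q′`, `X_u = Q·R₀(Σ_i u_iP_i)R₀·Q′` (PART 147's `Σ̇ = c⁻¹ċ… = c⁻¹X¹c⁻¹` in several directions). [folklore] -/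
theorem fderiv_effFormPencil_apply (D : Matrix p p ℝ) (P : ι → Matrix p p ℝ) (Q : Matrix q p ℝ) (Q' : Matrix p q ℝ) (S₀ : Matrix q q ℝ)
    {B₀ : ι → ℝ} (hA : IsUnit (D + ∑ i, B₀ i • P i).det) (hc : IsUnit (Q * (D + ∑ i, B₀ i • P i)⁻¹ * Q').det) (u : ι → ℝ) :
    fderiv ℝ (fun B : ι → ℝ => (Q * (D + ∑ i, B i • P i)⁻¹ * Q')⁻¹ + S₀) B₀ u =
      (Q * (D + ∑ i, B₀ i • P i)⁻¹ * Q')⁻¹ * (Q * ((D + ∑ i, B₀ i • P i)⁻¹ * (∑ i, u i • P i) * (D + ∑ i, B₀ i • P i)⁻¹) * Q')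
        * (Q * (D + ∑ i, B₀ i • P i)⁻¹ * Q')⁻¹ := by
  have hcd : DifferentiableAt ℝ (fun B : ι → ℝ => Q * (D + ∑ i, B i • P i)⁻¹ * Q') B₀ := (contDiffAt_sandwich (k := 1) D P Q Q' hA).differentiableAt one_ne_zero
  rw [show (fun B : ι → ℝ => (Q * (D + ∑ i, B i • P i)⁻¹ * Q')⁻¹ + S₀)
      = fun B => (fun B : ι → ℝ => (Q * (D + ∑ i, B i • P i)⁻¹ * Q')⁻¹) B + S₀ from rfl,
    fderiv_add_const, fderiv_nonsing_inv_apply hcd hc, fderiv_sandwich_apply D P Q Q' hA]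
  simp only [Matrix.mul_neg, Matrix.neg_mul, neg_neg]

/-- **THE MIXED SECOND JET: `D²Σ(B₀)[u,v] = c₀⁻¹X_uc₀⁻¹X_vc₀⁻¹ + c₀⁻¹X_vc₀⁻¹X_uc₀⁻¹ − c₀⁻¹(X_{uv} + X_{vu})c₀⁻¹`**, `X_{uv} = Q·R₀(Σu_iP_i)R₀(Σv_iP_i)R₀·Q′`
(PART 157's `Σ̈ = 2(c⁻¹X¹c⁻¹X¹c⁻¹ − c⁻¹X²c⁻¹)` is the diagonal `u = v`). [folklore] -/
theorem fderiv_fderiv_effFormPencil_apply (D : Matrix p p ℝ) (P : ι → Matrix p p ℝ) (Q : Matrix q p ℝ) (Q' : Matrix p q ℝ) (S₀ : Matrix q q ℝ)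
    {B₀ : ι → ℝ} (hA : IsUnit (D + ∑ i, B₀ i • P i).det) (hc : IsUnit (Q * (D + ∑ i, B₀ i • P i)⁻¹ * Q').det) (u v : ι → ℝ) :
    fderiv ℝ (fderiv ℝ (fun B : ι → ℝ => (Q * (D + ∑ i, B i • P i)⁻¹ * Q')⁻¹ + S₀)) B₀ u v =
      (Q * (D + ∑ i, B₀ i • P i)⁻¹ * Q')⁻¹ * (Q * ((D + ∑ i, B₀ i • P i)⁻¹ * (∑ i, u i • P i) * (D + ∑ i, B₀ i • P i)⁻¹) * Q')
          * (Q * (D + ∑ i, B₀ i • P i)⁻¹ * Q')⁻¹ * (Q * ((D + ∑ i, B₀ i • P i)⁻¹ * (∑ i, v i • P i) * (D + ∑ i, B₀ i • P i)⁻¹) * Q')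
          * (Q * (D + ∑ i, B₀ i • P i)⁻¹ * Q')⁻¹
        + (Q * (D + ∑ i, B₀ i • P i)⁻¹ * Q')⁻¹ * (Q * ((D + ∑ i, B₀ i • P i)⁻¹ * (∑ i, v i • P i) * (D + ∑ i, B₀ i • P i)⁻¹) * Q')
          * (Q * (D + ∑ i, B₀ i • P i)⁻¹ * Q')⁻¹ * (Q * ((D + ∑ i, B₀ i • P i)⁻¹ * (∑ i, u i • P i) * (D + ∑ i, B₀ i • P i)⁻¹) * Q')
          * (Q * (D + ∑ i, B₀ i • P i)⁻¹ * Q')⁻¹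
        - (Q * (D + ∑ i, B₀ i • P i)⁻¹ * Q')⁻¹
          * (Q * ((D + ∑ i, B₀ i • P i)⁻¹ * (∑ i, u i • P i) * (D + ∑ i, B₀ i • P i)⁻¹ * (∑ i, v i • P i) * (D + ∑ i, B₀ i • P i)⁻¹
              + (D + ∑ i, B₀ i • P i)⁻¹ * (∑ i, v i • P i) * (D + ∑ i, B₀ i • P i)⁻¹ * (∑ i, u i • P i) * (D + ∑ i, B₀ i • P i)⁻¹) * Q')
          * (Q * (D + ∑ i, B₀ i • P i)⁻¹ * Q')⁻¹ := by
  have hcs : ContDiffAt ℝ 2 (fun B : ι → ℝ => Q * (D + ∑ i, B i • P i)⁻¹ * Q') B₀ := contDiffAt_sandwich D P Q Q' hA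
  have hsplit : (fun B : ι → ℝ => (Q * (D + ∑ i, B i • P i)⁻¹ * Q')⁻¹ + S₀)
      = fun B => (fun B : ι → ℝ => (Q * (D + ∑ i, B i • P i)⁻¹ * Q')⁻¹) B + S₀ := rfl
  have h1 : fderiv ℝ (fun B : ι → ℝ => (Q * (D + ∑ i, B i • P i)⁻¹ * Q')⁻¹ + S₀)
      = fderiv ℝ (fun B : ι → ℝ => (Q * (D + ∑ i, B i • P i)⁻¹ * Q')⁻¹) := by
    rw [hsplit]; funext B; rw [fderiv_add_const]
  rw [h1, fderiv_fderiv_nonsing_inv hcs hc, fderiv_sandwich_apply D P Q Q' hA, fderiv_sandwich_apply D P Q Q' hA,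
    fderiv_fderiv_sandwich_apply D P Q Q' hA]
  simp only [Matrix.mul_neg, Matrix.neg_mul, neg_mul_neg]

end Sandwich

/-! ## §4 Entrywise readings at `B = 0` along the coordinate vectors — the `Family` currency of `LogDetHessian` -/

section Entrywise

variable {ι : Type*} [Fintype ι] [DecidableEq ι] {p q : Type*} [Fintype p] [DecidableEq p] [Fintype q] [DecidableEq q]

omit [Fintype p] [DecidableEq p] [Fintype q] [DecidableEq q] in
/-- `Σ_i (e_j)_i • P_i = P_j`. [folklore] -/
theorem sum_smul_single (P : ι → Matrix p p ℝ) (j : ι) : ∑ i, (Pi.single j (1 : ℝ) : ι → ℝ) i • P i = P j := by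
  rw [Finset.sum_eq_single j (fun i _ hij => by simp [Pi.single_eq_of_ne hij]) (fun h => absurd (Finset.mem_univ j) h)]
  simp

omit [DecidableEq ι] [Fintype p] [DecidableEq p] [Fintype q] [DecidableEq q] in
/-- At `B = 0` the pencil is `D`. [folklore] -/
theorem pencil_zero (D : Matrix p p ℝ) (P : ι → Matrix p p ℝ) : D + ∑ i, (0 : ι → ℝ) i • P i = D := by simp

omit [DecidableEq ι] in
/-- **`hΔ` OF `polarization_master`**: every entry of `Σ(B) = (Q·(D + Σ_i B_iP_i)⁻¹·Q′)⁻¹ + S₀` is `C²` (indeed `C^k` for every `k`) at `B = 0` when `D` and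
`c = Q·D⁻¹·Q′` are nonsingular. [folklore] -/
theorem contDiffAt_effFormPencil_entry {k : WithTop ℕ∞} (D : Matrix p p ℝ) (P : ι → Matrix p p ℝ) (Q : Matrix q p ℝ) (Q' : Matrix p q ℝ)
    (S₀ : Matrix q q ℝ) (hD : IsUnit D.det) (hc : IsUnit (Q * D⁻¹ * Q').det) (a b : q) :
    ContDiffAt ℝ k (fun B : ι → ℝ => ((Q * (D + ∑ i, B i • P i)⁻¹ * Q')⁻¹ + S₀) a b) 0 := by
  have hA : IsUnit (D + ∑ i, (0 : ι → ℝ) i • P i).det := by rwa [pencil_zero]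
  have hc' : IsUnit (Q * (D + ∑ i, (0 : ι → ℝ) i • P i)⁻¹ * Q').det := by rwa [pencil_zero]
  exact (LinearMap.toContinuousLinearMap (Matrix.entryLinearMap ℝ ℝ a b)).contDiff.contDiffAt.comp 0 (contDiffAt_effFormPencil (k := k) D P Q Q' S₀ hA hc')

/-- **`Family.dΔ` OF A RESOLVENT-FORM FAMILY = THE FIRST INSERTION WORD**: `of (a b ↦ fderiv (B ↦ Σ(B) a b) 0 e_i) = c⁻¹·X_i·c⁻¹`, `c = Q·D⁻¹·Q′`,
`X_i = Q·D⁻¹P_iD⁻¹·Q′`. [folklore] -/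
theorem of_fderiv_effFormPencil_entry_single (D : Matrix p p ℝ) (P : ι → Matrix p p ℝ) (Q : Matrix q p ℝ) (Q' : Matrix p q ℝ)
    (S₀ : Matrix q q ℝ) (hD : IsUnit D.det) (hc : IsUnit (Q * D⁻¹ * Q').det) (i : ι) :
    Matrix.of (fun a b => fderiv ℝ (fun B : ι → ℝ => ((Q * (D + ∑ i, B i • P i)⁻¹ * Q')⁻¹ + S₀) a b) 0 (Pi.single i 1))
      = (Q * D⁻¹ * Q')⁻¹ * (Q * (D⁻¹ * P i * D⁻¹) * Q') * (Q * D⁻¹ * Q')⁻¹ := by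
  have hA : IsUnit (D + ∑ i, (0 : ι → ℝ) i • P i).det := by rwa [pencil_zero]
  have hc' : IsUnit (Q * (D + ∑ i, (0 : ι → ℝ) i • P i)⁻¹ * Q').det := by rwa [pencil_zero]
  have hdiff : DifferentiableAt ℝ (fun B : ι → ℝ => (Q * (D + ∑ i, B i • P i)⁻¹ * Q')⁻¹ + S₀) 0 :=
    (contDiffAt_effFormPencil (k := 1) D P Q Q' S₀ hA hc').differentiableAt one_ne_zero
  have e : Matrix.of (fun a b => fderiv ℝ (fun B : ι → ℝ => ((Q * (D + ∑ i, B i • P i)⁻¹ * Q')⁻¹ + S₀) a b) 0 (Pi.single i 1))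
      = fderiv ℝ (fun B : ι → ℝ => (Q * (D + ∑ i, B i • P i)⁻¹ * Q')⁻¹ + S₀) 0 (Pi.single i 1) := by
    exact of_fderiv_entry hdiff _
  rw [e, fderiv_effFormPencil_apply D P Q Q' S₀ hA hc', sum_smul_single, pencil_zero]

/-- **`Family.d2Δ` OF A RESOLVENT-FORM FAMILY = THE POLARISED SECOND INSERTION WORDS**:
`of (a b ↦ hessianAt (B ↦ Σ(B) a b) i j) = c⁻¹X_ic⁻¹X_jc⁻¹ + c⁻¹X_jc⁻¹X_ic⁻¹ − c⁻¹(X_{ij} + X_{ji})c⁻¹`, `X_{ij} = Q·D⁻¹P_iD⁻¹P_jD⁻¹·Q′` — the mixed second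
partial of the effective form in two background directions IS this `ℤ`-combination of PART 159's words (gen 56 located it «by polarisation, not typed»). [folklore] -/
theorem of_hessianAt_effFormPencil_entry (D : Matrix p p ℝ) (P : ι → Matrix p p ℝ) (Q : Matrix q p ℝ) (Q' : Matrix p q ℝ)
    (S₀ : Matrix q q ℝ) (hD : IsUnit D.det) (hc : IsUnit (Q * D⁻¹ * Q').det) (i j : ι) :
    Matrix.of (fun a b => hessianAt (fun B : ι → ℝ => ((Q * (D + ∑ i, B i • P i)⁻¹ * Q')⁻¹ + S₀) a b) i j)
      = (Q * D⁻¹ * Q')⁻¹ * (Q * (D⁻¹ * P i * D⁻¹) * Q') * (Q * D⁻¹ * Q')⁻¹ * (Q * (D⁻¹ * P j * D⁻¹) * Q') * (Q * D⁻¹ * Q')⁻¹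
        + (Q * D⁻¹ * Q')⁻¹ * (Q * (D⁻¹ * P j * D⁻¹) * Q') * (Q * D⁻¹ * Q')⁻¹ * (Q * (D⁻¹ * P i * D⁻¹) * Q') * (Q * D⁻¹ * Q')⁻¹
        - (Q * D⁻¹ * Q')⁻¹ * (Q * (D⁻¹ * P i * D⁻¹ * P j * D⁻¹ + D⁻¹ * P j * D⁻¹ * P i * D⁻¹) * Q') * (Q * D⁻¹ * Q')⁻¹ := by
  have hA : IsUnit (D + ∑ i, (0 : ι → ℝ) i • P i).det := by rwa [pencil_zero]
  have hc' : IsUnit (Q * (D + ∑ i, (0 : ι → ℝ) i • P i)⁻¹ * Q').det := by rwa [pencil_zero]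
  have h2 : ContDiffAt ℝ 2 (fun B : ι → ℝ => (Q * (D + ∑ i, B i • P i)⁻¹ * Q')⁻¹ + S₀) 0 := contDiffAt_effFormPencil D P Q Q' S₀ hA hc'
  have e : Matrix.of (fun a b => hessianAt (fun B : ι → ℝ => ((Q * (D + ∑ i, B i • P i)⁻¹ * Q')⁻¹ + S₀) a b) i j)
      = fderiv ℝ (fderiv ℝ (fun B : ι → ℝ => (Q * (D + ∑ i, B i • P i)⁻¹ * Q')⁻¹ + S₀)) 0 (Pi.single i 1) (Pi.single j 1) := by
    simp only [hessianAt, iteratedFDeriv_two_apply, Matrix.cons_val_zero, Matrix.cons_val_one]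
    exact of_fderiv_fderiv_entry (K := fun B : ι → ℝ => (Q * (D + ∑ i, B i • P i)⁻¹ * Q')⁻¹ + S₀) h2 _ _
  rw [e, fderiv_fderiv_effFormPencil_apply D P Q Q' S₀ hA hc', sum_smul_single, sum_smul_single, pencil_zero]

end Entrywise

end Summit.QuantumFields.BalabanUV.Beta.GAN24.ResolventFamilyJets

end
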